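import Summits.QuantumFields.YangMills.Theses.FemtoCutoffLadder
import Summits.QuantumFields.YangMills.Theorems.FemtoCutoffLadderWalledSecondPos
import HarnessLib

/-!
# Route `FemtoCutoffLadder`: the ADDITIVE form of the crux `LargeFieldInsensitivityR` (stmt-QuantumFields-26197), by name

Seat `leafhand-qf-femtocutoffladder-1` g0 (2026-08-30).  All four factors of the two comparison clauses of `LargeFieldInsensitivityR` are positive on
the femto window — `λ₀` (`topValue_pos`), `λ₁` (`secondValue_su2Rep_pos`), the SF_κ-compressed top value `t_κ` (`SFCompression.smallFieldTop_pos`,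
p607603) and the SF_κ-compressed second value `s_κ` (`SFCompression.smallFieldSecond_pos`, p793746) — so clause 1 is automatic and clauses 2–3 are
the two signs of ONE absolute bound (`SFCompression.wallComparisons_iff_abs_le`):

★ `largeFieldInsensitivityR_iff_abs_log : LargeFieldInsensitivityR ↔ ∀ κ σ … |z_κ − z| ≤ CΛ²/L^σ + A/β²`, `z = L·(log λ₀ − log λ₁)`,
`z_κ = L·(log t_κ − log s_κ)` (same quantifier prefix and `let P`, VERBATIM) — the currency of the lead's memos («|z_κ − z| ≤ A/β², L-uniform»,
`Cruxes/LargeFieldInsensitivityR/Lines/beta_allowance.md`).  HONEST FRAMING: a by-name door; the bound (open, behind `UVStabilityNonUniqueness`) is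
untouched.  R2b1 is a RECORD rung: not infinite volume, not a mass gap, not Clay; no summit is proved by this file.  No definitions, no `sorry`.
-/

set_option autoImplicit false

noncomputable section

namespace Summit.QuantumFields.YangMills.Theorems.FemtoCutoffLadder

open Literature.MathematicalPhysics.QuantumFieldTheory hiding SU2
open Summit.QuantumFields.YangMills.Theorems.FemtoTransferGap
open Summit.QuantumFields.YangMills.Theses.FemtoCutoffLadder

/-- ★ **`LargeFieldInsensitivityR` ⟺ its additive form** `|z_κ − z| ≤ CΛ²/L^σ + A/β²` along the femto window (clause 1 `0 < t_κ` is automatic,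
`smallFieldTop_pos`; clauses 2–3 ⟺ the absolute bound, `wallComparisons_iff_abs_le` with `topValue_pos`, `secondValue_su2Rep_pos`,
`smallFieldSecond_pos`). [folklore] -/
theorem largeFieldInsensitivityR_iff_abs_log :
    LargeFieldInsensitivityR ↔
      (∀ κ σ : ℝ, 0 < κ → κ < 1 → 0 < σ → ∃ (C A lam0 : ℝ) (L0 : ℕ), 0 ≤ C ∧ 0 ≤ A ∧ 0 < lam0 ∧ ∀ lam : ℝ, 0 < lam → lam ≤ lam0 → ∀ (L : ℕ) [NeZero L], L0 ≤ L → ∀ β : ℝ, InFemtoWindow lam β L → let P : (Literature.MathematicalPhysics.QuantumFieldTheory.GaugeConfig 3 L SU2 → ℝ) → Prop := fun ψ => ∀ U, (∃ p : Literature.MathematicalPhysics.QuantumFieldTheory.Plaquette 3 L, β ^ (κ - 1) < 2 - (su2Rep (Literature.MathematicalPhysics.QuantumFieldTheory.plaquetteHolonomy U p.1 p.2.1.1 p.2.1.2)).trace.re) → ψ U = 0; |(L : ℝ) * (Real.log (sSup (rayleighSet su2Rep L β P)) - Real.log (sInf {x : ℝ | ∃ φ : Literature.MathematicalPhysics.QuantumFieldTheory.GaugeConfig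 3 L SU2 → ℝ, IsPhys φ ∧ x = sSup (rayleighSet su2Rep L β fun ψ => P ψ ∧ l2 ψ φ = 0)})) - (L : ℝ) * (Real.log (topValue su2Rep L β) - Real.log (secondValue su2Rep L β))| ≤ C * luscherLambda β L ^ 2 / (L : ℝ) ^ σ + A / β ^ 2) := by
  constructor
  · intro h κ σ hκ hκ1 hσ
    obtain ⟨C, A, lam0, L0, hC, hA, hlam0, H⟩ := h κ σ hκ hκ1 hσ
    refine ⟨C, A, lam0, L0, hC, hA, hlam0, fun lam hlam hle L _ hL0 β hW => ?_⟩
    have hβ : 0 < β := by linarith [hW.1]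
    intro P
    obtain ⟨ht, hc⟩ := H lam hlam hle L hL0 β hW
    exact (SFCompression.wallComparisons_iff_abs_le (SFCompression.smallFieldSecond_pos L hβ κ) ht
      (secondValue_su2Rep_pos hβ) (topValue_pos su2Rep continuous_su2Rep (L := L) β) L).mp hc
  · intro h κ σ hκ hκ1 hσ
    obtain ⟨C, A, lam0, L0, hC, hA, hlam0, H⟩ := h κ σ hκ hκ1 hσ
    refine ⟨C, A, lam0, L0, hC, hA, hlam0, fun lam hlam hle L _ hL0 β hW => ?_⟩
    have hβ : 0 < β := by linarith [hW.1]
    intro P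
    have ht := SFCompression.smallFieldTop_pos L hβ κ
    exact ⟨ht, (SFCompression.wallComparisons_iff_abs_le (SFCompression.smallFieldSecond_pos L hβ κ) ht
      (secondValue_su2Rep_pos hβ) (topValue_pos su2Rep continuous_su2Rep (L := L) β) L).mpr (H lam hlam hle L hL0 β hW)⟩

end Summit.QuantumFields.YangMills.Theorems.FemtoCutoffLadder

end
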